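import Summits.QuantumFields.BalabanUV.Beta.SecondOrderInverseShape
import Summits.QuantumFields.BalabanUV.Beta.WardLocusCubic
import Summits.QuantumFields.BalabanUV.Beta.SpineRecursiveW

/-!
# `BalabanUV.Beta.WardLocusQuartic` — binder row D1, (L4) W-side of hW: **THE SECOND-ORDER WARD LAW PROPAGATES THROUGH THE RELATIVE
# INVERSE** — `divW (K3OfK K N S M W) y ν y′ = conjV (K2OfK K N S M ν y′) (X y) − K∘𝒩∘K`, its `mm`-read (= the site law of the next
# level's quartic table `e4OfKW`) and the block law at the next level (β sub-cell, D1 formalisation swarm, unit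
# `b2b-balaban-beta-d1-formalise-leaf-10`, gen 3; CLAIM «D1-hW-L4-WARD-STEP», journal l.11266)

NOT IN PRINT; OUR BOOKKEEPING.  HONEST FRAMING (cell charter, verbatim): «discharging `BetaPertH` makes Bałaban's UV stability
UNCONDITIONAL — a real constructive-QFT result; it is NOT the continuum limit and NOT the Clay problem.»  HONEST DEPENDENCY (verbatim):
«continuum YM on T⁴ ⇐ BetaPertH ∧ nine spine estimates (0/9 proved); BetaPertH ⇐ (D1) ∧ (D4) ∧ CAP+tail; G-an2-4 gates asym, D1 and
NE2/3/4.»  [folklore] kernel algebra over tree objects BY NAME; every law is a DISPLAYED HYPOTHESIS (socket); no statement of Bałaban's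
papers, no `[cite:]`, no `def`, no `def … : Prop`; instantiates NO binder of the β-function wall.  NOT D1, NOT `BetaPertH`, NOT continuum, NOT Clay.

WHY.  an1's hW reduction (`KernelWardRelativeEnd` / `KernelWardResidual`) + leaf-10's `KernelWardSymAssembly` turn the level-`j` TABLE laws
(T2-S₂)/(T2-M₂) into the level-`j` KERNEL law `divW (W2SymOfK …) y ν y′ = conjV (dM …) (X y) + Nr`.  The recursive W-literal's field–field
table of level `j+1` is `(cE₂·wV4) • e4OfKW Lc G_j (SpureRecAt j) (M1At j) (WrecAt j) + (cB·wB2) • vh₂S` (`SpineRecursiveW.T2RecAt_succ`),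
`e4OfKW Lc K S M W b c = mmRead Lc (K3OfK K Lc S M W b c)`; so the (T2-S₂) law AT LEVEL `j+1` must come from the KERNEL law at level `j` —
the order-2 twin of `WardLocusCubic.divV_e3K_eq_conjV` / `WardLocusInduction.hSd_step` and the Ward twin of an2-g18's
`SecondOrderInverseShape.K3_sharp_rel`.  WHAT: §1 `K3_ward_rel` (abstract `RelInv A 𝕄 E`, `[E,X] = 0`: the three words of `divW K3OfK`, with
the first-order law `divV D = conjV 𝕄 X`, its consequence `divV K2 = −A∘conjV 𝕄 X∘A` and the second-order law `divW W (·) c = conjV D_c X + 𝒩`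
inserted, collapse to `conjV (K2 c) X − A∘𝒩∘A` — every sandwiched word cancels in pairs: `sandwich_K2`, `sandwich_conjV_rel`); §2
**`divW_K3OfK_of_laws`** (+ `_of_decay`); §3 **`divV_e4OfKW_eq`**: for the block-rotation generator `X y = diagK (ξ • Σ_{v ∈ box N} legInd ρ (N•y+v))`,
`divV (e4OfKW N K S M W · ν y′) y₀ = ξ • conjV (mmRead N (K2OfK … ν y′)) (diagK (legInd ρ′ y₀)) − mmRead N (K∘𝒩 y₀ ν y′∘K)` (`mmRead_conjV_diagK`,
`mmSym_blockGen_inl`); §4 **`blockLaw_e4OfKW`**, **`tableLaw_e4OfKW_sector`** = the `hS₂`/`hS₂''` shape of `KernelWardSymAssembly` at the next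
level for the `e4OfKW` SECTOR, remainder `−(cH′·a₂) • Σ_v mmRead N (K∘𝒩∘K)` DISPLAYED, ONE scalar lock `cH′·a₂·ξ = a₁·ξ′` (the `vh₂S` border
sector and the units locks are NOT here: an1 / the row owner).  The WALL INSTANCE (over `G_j = coDressKBmAt ρ Lc (KInvStep Lc j)`, `𝕄_j = bhKStepAt j`, `E = axEc`, pin, generator scale
`½`, only hypothesis the level-`j` kernel law of `WrecAt j`) is the sibling module `WardLocusQuarticWall`.
Provenance: D1 formalisation swarm, leaf prover 10 (gen 3), 2026-08-20; no existing file touched.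
-/


noncomputable section

open Finset
open scoped BigOperators
open Literature.MathematicalPhysics.QuantumFieldTheory
open Literature.MathematicalPhysics.QuantumFieldTheory.Balaban1983to89
open Literature.MathematicalPhysics.QuantumFieldTheory.Balaban1983to89.Beta
open ExpKernelCalculus (MKer Decays BiLoc VertexFamily VertexFamily₂ comp)
open KernelWard (divV divW bdd_of_biLoc)
open AffineAveraging (box toSite)
open OneStepResolventKernel (Fib LocStencil)
open OneStepKernelFamily (colH vertexOfK)
open BalabanStepJetsSucc (mmRead)
open SecondOrderResponse (vertexOfM dM K2OfK vertexFamily_dM)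
open BalabanStepW2 (K3OfK)
open Summit.QuantumFields.BalabanUV.Beta.TameKernelCalculus
open Summit.QuantumFields.BalabanUV.Beta.ChartConjugation (conjV loc_conjV)
open Summit.QuantumFields.BalabanUV.Beta.ChartConjugationRelative (RelInv spr_comp sandwich_conjV_rel)
open Summit.QuantumFields.BalabanUV.Beta.SecondOrderInverseShape (sandwich_K2)
open Summit.QuantumFields.BalabanUV.Beta.SecondOrderTransport (K2OfK_eq)
open Summit.QuantumFields.BalabanUV.Beta.BorderedHessian (diagK)
open Summit.QuantumFields.BalabanUV.Beta.AveragingWardRootedStencils (legInd legInd_inl)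
open Summit.QuantumFields.BalabanUV.Beta.WardLocusCubic (comp_finset_sum_right comp_finset_sum_left mmRead_finset_sum mmRead_conjV_diagK
  mmSym_blockGen_inl conjV_mmRead_diagK_congr conjV_smul_diagK)
open Summit.QuantumFields.BalabanUV.Beta.WardLocusS0N (conjV_diagK_smul conjV_diagK_sum)
open Summit.QuantumFields.BalabanUV.Beta.GAN24.ThirdJetKernel (mmRead_sub mmRead_smul)
open Summit.QuantumFields.BalabanUV.Beta.SpineRooted (e4OfKW)

namespace Summit.QuantumFields.BalabanUV.Beta.WardLocusQuartic

/-! ## §1 The abstract Ward shape: every sandwiched word cancels in pairs -/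

section Abstract

variable {D : ℕ} {F : Type*} [Fintype F] {A M E : MKer D F}

/-- [folklore] **THE SECOND-ORDER WARD SHAPE PASSES TO THE (RELATIVE) INVERSE** (abstract letters).  For `RelInv A 𝕄 E` (all spread), a
localised generator `X` commuting with `E`, a localised first-order letter `Dc` and a localised inhomogeneity `𝒩`: the three words of the
bond divergence of `K3` — `−(A∘(𝕄X − X𝕄))∘K2c` (first word, first-order law inserted), `−(A∘Dc)∘(−(A∘(𝕄X − X𝕄))∘A)` (second word, the
divergence of the differentiated inverse inserted) and `−(A∘((DcX − XDc) + 𝒩))∘A` (third word, the second-order law inserted) — sum to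
`conjV K2c X − A∘𝒩∘A`, `K2c := −(A∘Dc)∘A`. -/
theorem K3_ward_rel (hA : Spr A) (hM : Spr M) (hE : Spr E) (hR : RelInv A M E) {X Dc Nn : MKer D F} (hX : Loc X) (hDc : Loc Dc)
    (hN : Loc Nn) (hEX : comp E X = comp X E) :
    -(comp (comp A (conjV M X)) (-(comp (comp A Dc) A))) - comp (comp A Dc) (-(comp (comp A (conjV M X)) A))
        - comp (comp A (conjV Dc X + Nn)) A =
      conjV (-(comp (comp A Dc) A)) X - comp (comp A Nn) A := by
  have hcV : Loc (conjV M X) := loc_conjV hM hX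
  have hP : Loc (comp A (conjV M X)) := hA.comp_loc hcV
  have hADc : Loc (comp A Dc) := hA.comp_loc hDc
  have hQ : Loc (comp (comp A Dc) A) := hADc.comp_spr hA
  have hcD : Loc (conjV Dc X) := (hDc.comp hX).sub (hX.comp hDc)
  -- word 1: `(A∘conjV 𝕄 X)∘((A∘Dc)∘A) = X∘((A∘Dc)∘A) − ((A∘X)∘Dc)∘A`
  have e1 : -(comp (comp A (conjV M X)) (-(comp (comp A Dc) A))) =
      comp X (comp (comp A Dc) A) - comp (comp (comp A X) Dc) A := by
    rw [comp_neg_right, neg_neg, sandwich_K2 hA hM hE hR hX hDc hEX]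
  -- word 2: `(A∘Dc)∘(−conjV A X)`
  have e2 : -(comp (comp A Dc) (-(comp (comp A (conjV M X)) A))) =
      -(comp (comp (comp A Dc) A) X) + comp (comp A (comp Dc X)) A := by
    rw [comp_neg_right, neg_neg, sandwich_conjV_rel hA hM hE hR hX hEX, comp_neg_right]
    unfold conjV
    rw [comp_sub_right_tame hADc.tame (hA.comp_loc hX).tame (hX.comp_spr hA).tame,
      comp_assoc_tame hADc.tame hA.tame hX.tame, comp_assoc_tame hADc.tame hX.tame hA.tame, comp_assoc_tame hA.tame hDc.tame hX.tame]
    abel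
  -- word 3: `(A∘(conjV Dc X + 𝒩))∘A`
  have e3 : -(comp (comp A (conjV Dc X + Nn)) A) =
      -(comp (comp A (comp Dc X)) A) + comp (comp (comp A X) Dc) A - comp (comp A Nn) A := by
    rw [comp_add_right_tame hA.tame hcD.tame hN.tame, comp_add_left_tame (hA.comp_loc hcD).tame (hA.comp_loc hN).tame hA.tame]
    unfold conjV
    rw [comp_sub_right_tame hA.tame (hDc.comp hX).tame (hX.comp hDc).tame,
      comp_sub_left_tame (hA.comp_loc (hDc.comp hX)).tame (hA.comp_loc (hX.comp hDc)).tame hA.tame,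
      ← comp_assoc_tame hA.tame hX.tame hDc.tame]
    abel
  -- the right-hand side
  have e4 : conjV (-(comp (comp A Dc) A)) X = -(comp (comp (comp A Dc) A) X) + comp X (comp (comp A Dc) A) := by
    unfold conjV
    rw [comp_neg_left, comp_neg_right]
    abel
  rw [sub_eq_add_neg, sub_eq_add_neg, e1, e2, e3, e4]
  abel

end Abstract

/-! ## §2 The kernel law: `divW K3OfK = conjV (K2OfK c) X − K∘𝒩∘K` -/

section Kernel

variable {d N : ℕ}

/-- [folklore] **THE SANDWICH IS LINEAR OVER THE BOND DIVERGENCE**: for spread `A`, tame `B` and localised `V μ y`,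
`(A ∘ divV V y) ∘ B = Σ_μ ((A ∘ V μ (y − e_μ)) ∘ B − (A ∘ V μ y) ∘ B)`. -/
theorem comp_comp_divV {A B : MKer (d + 1) (Fib d)} (hA : Spr A) (hB : Tame B) {V : Fin (d + 1) → (Fin (d + 1) → ℤ) → MKer (d + 1) (Fib d)}
    (hV : ∀ μ y, Loc (V μ y)) (y : Fin (d + 1) → ℤ) :
    comp (comp A (divV V y)) B = ∑ μ, (comp (comp A (V μ (y - B6BondElimination.unitVec μ))) B - comp (comp A (V μ y)) B) := by
  have hD : ∀ μ : Fin (d + 1), Loc (V μ (y - B6BondElimination.unitVec μ) - V μ y) := fun μ => (hV μ _).sub (hV μ y)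
  unfold KernelWard.divV
  rw [comp_finset_sum_right Finset.univ hA.tame hD, comp_finset_sum_left Finset.univ (fun μ => hA.comp_loc (hD μ)) hB]
  refine Finset.sum_congr rfl fun μ _ => ?_
  rw [comp_sub_right_tame hA.tame (hV μ _).tame (hV μ y).tame,
    comp_sub_left_tame (hA.comp_loc (hV μ _)).tame (hA.comp_loc (hV μ y)).tame hB]

/-- [folklore] `A ∘ (Σ_μ (F μ − G μ)) = Σ_μ (A ∘ F μ − A ∘ G μ)` for tame `A` and localised families. -/
theorem comp_sum_sub {A : MKer (d + 1) (Fib d)} (hA : Tame A) {F G : Fin (d + 1) → MKer (d + 1) (Fib d)} (hF : ∀ μ, Loc (F μ))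
    (hG : ∀ μ, Loc (G μ)) : comp A (∑ μ, (F μ - G μ)) = ∑ μ, (comp A (F μ) - comp A (G μ)) := by
  rw [comp_finset_sum_right Finset.univ hA (fun μ => (hF μ).sub (hG μ))]
  exact Finset.sum_congr rfl fun μ _ => comp_sub_right_tame hA (hF μ).tame (hG μ).tame

/-- [folklore] `K3OfK` as a kernel expression (definitional). -/
theorem K3OfK_eq (K : MKer (d + 1) (Fib d)) (S M : Fin (d + 1) → (Fin (d + 1) → ℤ) → MKer (d + 1) (Fib d))
    (W : Fin (d + 1) → (Fin (d + 1) → ℤ) → Fin (d + 1) → (Fin (d + 1) → ℤ) → MKer (d + 1) (Fib d))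
    (μ : Fin (d + 1)) (y : Fin (d + 1) → ℤ) (ν : Fin (d + 1)) (y' : Fin (d + 1) → ℤ) :
    K3OfK K N S M W μ y ν y' =
      -(comp (comp K (dM K N S M μ y)) (K2OfK K N S M ν y')) - comp (comp K (dM K N S M ν y')) (K2OfK K N S M μ y)
        - comp (comp K (W μ y ν y')) K := rfl

/-- [folklore] `divW W y ν y′` is the bond divergence of the first slot (definitional). -/
theorem divW_eq_divV (W : Fin (d + 1) → (Fin (d + 1) → ℤ) → Fin (d + 1) → (Fin (d + 1) → ℤ) → MKer (d + 1) (Fib d))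
    (y : Fin (d + 1) → ℤ) (ν : Fin (d + 1)) (y' : Fin (d + 1) → ℤ) : divW W y ν y' = divV (fun μ y => W μ y ν y') y := rfl

/-- [folklore] **THE SECOND-ORDER WARD LAW PROPAGATES THROUGH THE RELATIVE INVERSE.**  Let `K` be spread with `RelInv K 𝕄 E` (`𝕄`, `E`
spread), the first-order family `dM K N S M` and the second-order carrier `W` localised, the generators `X y` localised and commuting with `E`.
IF (hD) the first-order law `divV (dM K N S M) y = conjV 𝕄 (X y)` and (hWd) the second-order KERNEL law
`divW W y ν y′ = conjV (dM K N S M ν y′) (X y) + 𝒩 y ν y′` (localised `𝒩`) hold, THEN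
`divW (K3OfK K N S M W) y ν y′ = conjV (K2OfK K N S M ν y′) (X y) − K∘(𝒩 y ν y′)∘K`. -/
theorem divW_K3OfK_of_laws {K 𝕄 E : MKer (d + 1) (Fib d)} (hK : Spr K) (h𝕄 : Spr 𝕄) (hE : Spr E) (hR : RelInv K 𝕄 E)
    {S M : Fin (d + 1) → (Fin (d + 1) → ℤ) → MKer (d + 1) (Fib d)} (hDl : ∀ μ y, Loc (dM K N S M μ y))
    {W : Fin (d + 1) → (Fin (d + 1) → ℤ) → Fin (d + 1) → (Fin (d + 1) → ℤ) → MKer (d + 1) (Fib d)} (hWl : ∀ μ y ν y', Loc (W μ y ν y'))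
    {X : (Fin (d + 1) → ℤ) → MKer (d + 1) (Fib d)} (hX : ∀ y, Loc (X y)) (hEX : ∀ y, comp E (X y) = comp (X y) E)
    (hD : ∀ y, divV (dM K N S M) y = conjV 𝕄 (X y))
    {𝒩 : (Fin (d + 1) → ℤ) → Fin (d + 1) → (Fin (d + 1) → ℤ) → MKer (d + 1) (Fib d)} (h𝒩 : ∀ y ν y', Loc (𝒩 y ν y'))
    (hWd : ∀ y ν y', divW W y ν y' = conjV (dM K N S M ν y') (X y) + 𝒩 y ν y')
    (y : Fin (d + 1) → ℤ) (ν : Fin (d + 1)) (y' : Fin (d + 1) → ℤ) :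
    divW (K3OfK K N S M W) y ν y' = conjV (K2OfK K N S M ν y') (X y) - comp (comp K (𝒩 y ν y')) K := by
  -- localisation bookkeeping
  have hK2l : ∀ μ y, Loc (K2OfK K N S M μ y) := fun μ y => by
    rw [K2OfK_eq]; exact ((hK.comp_loc (hDl μ y)).comp_spr hK).neg
  set e := fun μ : Fin (d + 1) => B6BondElimination.unitVec μ with he
  -- the three bond divergences
  have h1 : ∑ μ, (comp (comp K (dM K N S M μ (y - e μ))) (K2OfK K N S M ν y') - comp (comp K (dM K N S M μ y)) (K2OfK K N S M ν y')) =
      comp (comp K (divV (dM K N S M) y)) (K2OfK K N S M ν y') := (comp_comp_divV hK (hK2l ν y').tame hDl y).symm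
  have h2 : ∑ μ, (K2OfK K N S M μ (y - e μ) - K2OfK K N S M μ y) = -(comp (comp K (divV (dM K N S M) y)) K) := by
    rw [comp_comp_divV hK hK.tame hDl y, ← Finset.sum_neg_distrib]
    refine Finset.sum_congr rfl fun μ _ => ?_
    rw [K2OfK_eq, K2OfK_eq]
    abel
  have h2' : ∑ μ, (comp (comp K (dM K N S M ν y')) (K2OfK K N S M μ (y - e μ)) - comp (comp K (dM K N S M ν y')) (K2OfK K N S M μ y)) =
      comp (comp K (dM K N S M ν y')) (∑ μ, (K2OfK K N S M μ (y - e μ) - K2OfK K N S M μ y)) :=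
    (comp_sum_sub (hK.comp_loc (hDl ν y')).tame (fun μ => hK2l μ _) (fun μ => hK2l μ y)).symm
  have h3 : ∑ μ, (comp (comp K (W μ (y - e μ) ν y')) K - comp (comp K (W μ y ν y')) K) = comp (comp K (divW W y ν y')) K := by
    rw [divW_eq_divV]; exact (comp_comp_divV hK hK.tame (V := fun μ y => W μ y ν y') (fun μ y => hWl μ y ν y') y).symm
  -- split the divergence of `K3OfK` into the three words
  have hsplit : divW (K3OfK K N S M W) y ν y' =
      -(∑ μ, (comp (comp K (dM K N S M μ (y - e μ))) (K2OfK K N S M ν y') - comp (comp K (dM K N S M μ y)) (K2OfK K N S M ν y')))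
      - ∑ μ, (comp (comp K (dM K N S M ν y')) (K2OfK K N S M μ (y - e μ)) - comp (comp K (dM K N S M ν y')) (K2OfK K N S M μ y))
      - ∑ μ, (comp (comp K (W μ (y - e μ) ν y')) K - comp (comp K (W μ y ν y')) K) := by
    unfold KernelWard.divW
    rw [← Finset.sum_neg_distrib, ← Finset.sum_sub_distrib, ← Finset.sum_sub_distrib]
    refine Finset.sum_congr rfl fun μ _ => ?_
    rw [K3OfK_eq, K3OfK_eq]
    abel
  rw [hsplit, h1, h2', h2, h3, hD y, hWd y ν y', K2OfK_eq K S M ν y']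
  exact K3_ward_rel hK h𝕄 hE hR (hX y) (hDl ν y') (h𝒩 y ν y') (hEX y)

/-- [folklore] The same with the localisations DISCHARGED from the decay classes (`Decays K C m`, `LocStencil S Cs m`, `VertexFamily M N CM m`,
`VertexFamily₂ W N Cw δw`): `SecondOrderResponse.vertexFamily_dM` and `BiLoc ⇒ Loc`. -/
theorem divW_K3OfK_of_laws_of_decay [NeZero N] {K 𝕄 E : MKer (d + 1) (Fib d)} {C m : ℝ} (hKd : Decays K C m) (hC : 0 ≤ C) (hm : 0 < m)
    (h𝕄 : Spr 𝕄) (hE : Spr E) (hR : RelInv K 𝕄 E)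
    {S : Fin (d + 1) → (Fin (d + 1) → ℤ) → MKer (d + 1) (Fib d)} {Cs : ℝ} (hS : LocStencil S Cs m)
    {M : Fin (d + 1) → (Fin (d + 1) → ℤ) → MKer (d + 1) (Fib d)} {CM : ℝ} (hM : VertexFamily M N CM m)
    {W : Fin (d + 1) → (Fin (d + 1) → ℤ) → Fin (d + 1) → (Fin (d + 1) → ℤ) → MKer (d + 1) (Fib d)} {Cw δw : ℝ} (hδw : 0 < δw)
    (hW : VertexFamily₂ W N Cw δw)
    {X : (Fin (d + 1) → ℤ) → MKer (d + 1) (Fib d)} (hX : ∀ y, Loc (X y)) (hEX : ∀ y, comp E (X y) = comp (X y) E)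
    (hD : ∀ y, divV (dM K N S M) y = conjV 𝕄 (X y))
    {𝒩 : (Fin (d + 1) → ℤ) → Fin (d + 1) → (Fin (d + 1) → ℤ) → MKer (d + 1) (Fib d)} (h𝒩 : ∀ y ν y', Loc (𝒩 y ν y'))
    (hWd : ∀ y ν y', divW W y ν y' = conjV (dM K N S M ν y') (X y) + 𝒩 y ν y')
    (y : Fin (d + 1) → ℤ) (ν : Fin (d + 1)) (y' : Fin (d + 1) → ℤ) :
    divW (K3OfK K N S M W) y ν y' = conjV (K2OfK K N S M ν y') (X y) - comp (comp K (𝒩 y ν y')) K := by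
  have hDv := vertexFamily_dM (N := N) hKd hC hS hM hm le_rfl
  exact divW_K3OfK_of_laws ⟨C, m, hm, hKd⟩ h𝕄 hE hR (fun μ y => ⟨_, _, _, _, half_pos hm, hDv μ y⟩)
    (fun μ y ν y' => ⟨_, _, _, _, hδw, hW μ y ν y'⟩) hX hEX hD h𝒩 hWd y ν y'

end Kernel

/-! ## §3 The `mm`-read: the site law of the next level's quartic table `e4OfKW` -/

section Read

variable {d N : ℕ}

/-- [folklore] `mmRead` passes through the bond divergence (it is linear). -/
theorem divV_mmRead (F : Fin (d + 1) → (Fin (d + 1) → ℤ) → MKer (d + 1) (Fib d)) (y : Fin (d + 1) → ℤ) :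
    divV (fun μ y => mmRead N (F μ y)) y = mmRead N (divV F y) := by
  simp only [KernelWard.divV, mmRead_finset_sum, mmRead_sub]

/-- [folklore] The first-slot bond divergence of `e4OfKW N K S M W` is the `mm`-read of `divW (K3OfK K N S M W)` (definitional + linearity). -/
theorem divV_e4OfKW_eq_mmRead (K : MKer (d + 1) (Fib d)) (S M : Fin (d + 1) → (Fin (d + 1) → ℤ) → MKer (d + 1) (Fib d))
    (W : Fin (d + 1) → (Fin (d + 1) → ℤ) → Fin (d + 1) → (Fin (d + 1) → ℤ) → MKer (d + 1) (Fib d))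
    (y₀ : Fin (d + 1) → ℤ) (ν : Fin (d + 1)) (y' : Fin (d + 1) → ℤ) :
    divV (fun μ y => e4OfKW N K S M W μ y ν y') y₀ = mmRead N (divW (K3OfK K N S M W) y₀ ν y') := by
  rw [divW_eq_divV]
  exact divV_mmRead (fun μ y => K3OfK K N S M W μ y ν y') y₀

/-- [folklore] **THE SITE WARD LAW OF THE NEXT LEVEL'S QUARTIC TABLE.**  Under the hypotheses of `divW_K3OfK_of_laws` with the BLOCK-ROTATION
generator `X y = diagK (ξ • Σ_{v ∈ box N} legInd ρ (N•y + v))` (in-block root `ρ = toSite r`):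
`divV (fun μ y ↦ e4OfKW N K S M W μ y ν y′) y₀ = ξ • conjV (mmRead N (K2OfK K N S M ν y′)) (diagK (legInd ρ′ y₀)) − mmRead N (K∘𝒩 y₀ ν y′∘K)` —
the diagonal contact of the `mm`-read of the differentiated inverse with the rotation generator of the ONE site `y₀` of the step lattice
(`mmRead_conjV_diagK`, `mmSym_blockGen_inl`; any root `ρ′` may be used to write it), plus the transported inhomogeneity. -/
theorem divV_e4OfKW_eq {K 𝕄 E : MKer (d + 1) (Fib d)} (hK : Spr K) (h𝕄 : Spr 𝕄) (hE : Spr E) (hR : RelInv K 𝕄 E)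
    {S M : Fin (d + 1) → (Fin (d + 1) → ℤ) → MKer (d + 1) (Fib d)} (hDl : ∀ μ y, Loc (dM K N S M μ y))
    {W : Fin (d + 1) → (Fin (d + 1) → ℤ) → Fin (d + 1) → (Fin (d + 1) → ℤ) → MKer (d + 1) (Fib d)} (hWl : ∀ μ y ν y', Loc (W μ y ν y'))
    {r : Fin (d + 1) → ℕ} (hr : r ∈ box (d + 1) N) (ξ : ℝ)
    (hX : ∀ y : Fin (d + 1) → ℤ, Loc (diagK (ξ • ∑ v ∈ box (d + 1) N, legInd (toSite r) ((N : ℤ) • y + toSite v))))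
    (hEX : ∀ y : Fin (d + 1) → ℤ, comp E (diagK (ξ • ∑ v ∈ box (d + 1) N, legInd (toSite r) ((N : ℤ) • y + toSite v))) =
      comp (diagK (ξ • ∑ v ∈ box (d + 1) N, legInd (toSite r) ((N : ℤ) • y + toSite v))) E)
    (hD : ∀ y : Fin (d + 1) → ℤ, divV (dM K N S M) y = conjV 𝕄 (diagK (ξ • ∑ v ∈ box (d + 1) N, legInd (toSite r) ((N : ℤ) • y + toSite v))))
    {𝒩 : (Fin (d + 1) → ℤ) → Fin (d + 1) → (Fin (d + 1) → ℤ) → MKer (d + 1) (Fib d)} (h𝒩 : ∀ y ν y', Loc (𝒩 y ν y'))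
    (hWd : ∀ (y : Fin (d + 1) → ℤ) (ν : Fin (d + 1)) (y' : Fin (d + 1) → ℤ), divW W y ν y' =
      conjV (dM K N S M ν y') (diagK (ξ • ∑ v ∈ box (d + 1) N, legInd (toSite r) ((N : ℤ) • y + toSite v))) + 𝒩 y ν y')
    (ρ' y₀ : Fin (d + 1) → ℤ) (ν : Fin (d + 1)) (y' : Fin (d + 1) → ℤ) :
    divV (fun μ y => e4OfKW N K S M W μ y ν y') y₀ =
      ξ • conjV (mmRead N (K2OfK K N S M ν y')) (diagK (legInd ρ' y₀)) - mmRead N (comp (comp K (𝒩 y₀ ν y')) K) := by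
  rw [divV_e4OfKW_eq_mmRead,
    divW_K3OfK_of_laws hK h𝕄 hE hR hDl hWl (X := fun y => diagK (ξ • ∑ v ∈ box (d + 1) N, legInd (toSite r) ((N : ℤ) • y + toSite v)))
      hX hEX hD h𝒩 hWd y₀ ν y',
    mmRead_sub, mmRead_conjV_diagK,
    conjV_mmRead_diagK_congr N (K2OfK K N S M ν y') (g' := ξ • legInd ρ' y₀) (fun x α => by
      rw [mmSym_blockGen_inl hr]; simp only [Pi.smul_apply, smul_eq_mul, legInd_inl]),
    conjV_diagK_smul]

end Read

/-! ## §4 The block law at the next level; the (T2-S₂)-shaped law of the `e4OfKW` sector -/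

section Block

variable {d N : ℕ}

/-- [folklore] **THE BLOCK WARD LAW OF THE QUARTIC TABLE AT THE NEXT LEVEL** (block size `N′`, coarse site `Y`, constant `cH′`): the site law
summed over the block — `cH′ • Σ_{v ∈ box N′} divV (e4OfKW … · ν y′) (N′•Y + v) = (cH′·ξ) • conjV (mmRead N (K2OfK … ν y′)) (diagK (Σ_v legInd ρ′ (N′•Y + v)))
− cH′ • Σ_v mmRead N (K∘𝒩 (N′•Y + v) ν y′∘K)`. -/
theorem blockLaw_e4OfKW {K 𝕄 E : MKer (d + 1) (Fib d)} (hK : Spr K) (h𝕄 : Spr 𝕄) (hE : Spr E) (hR : RelInv K 𝕄 E)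
    {S M : Fin (d + 1) → (Fin (d + 1) → ℤ) → MKer (d + 1) (Fib d)} (hDl : ∀ μ y, Loc (dM K N S M μ y))
    {W : Fin (d + 1) → (Fin (d + 1) → ℤ) → Fin (d + 1) → (Fin (d + 1) → ℤ) → MKer (d + 1) (Fib d)} (hWl : ∀ μ y ν y', Loc (W μ y ν y'))
    {r : Fin (d + 1) → ℕ} (hr : r ∈ box (d + 1) N) (ξ : ℝ)
    (hX : ∀ y : Fin (d + 1) → ℤ, Loc (diagK (ξ • ∑ v ∈ box (d + 1) N, legInd (toSite r) ((N : ℤ) • y + toSite v))))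
    (hEX : ∀ y : Fin (d + 1) → ℤ, comp E (diagK (ξ • ∑ v ∈ box (d + 1) N, legInd (toSite r) ((N : ℤ) • y + toSite v))) =
      comp (diagK (ξ • ∑ v ∈ box (d + 1) N, legInd (toSite r) ((N : ℤ) • y + toSite v))) E)
    (hD : ∀ y : Fin (d + 1) → ℤ, divV (dM K N S M) y = conjV 𝕄 (diagK (ξ • ∑ v ∈ box (d + 1) N, legInd (toSite r) ((N : ℤ) • y + toSite v))))
    {𝒩 : (Fin (d + 1) → ℤ) → Fin (d + 1) → (Fin (d + 1) → ℤ) → MKer (d + 1) (Fib d)} (h𝒩 : ∀ y ν y', Loc (𝒩 y ν y'))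
    (hWd : ∀ (y : Fin (d + 1) → ℤ) (ν : Fin (d + 1)) (y' : Fin (d + 1) → ℤ), divW W y ν y' =
      conjV (dM K N S M ν y') (diagK (ξ • ∑ v ∈ box (d + 1) N, legInd (toSite r) ((N : ℤ) • y + toSite v))) + 𝒩 y ν y')
    (cH' : ℝ) (N' : ℕ) (ρ' Y : Fin (d + 1) → ℤ) (ν : Fin (d + 1)) (y' : Fin (d + 1) → ℤ) :
    cH' • ∑ v ∈ box (d + 1) N', divV (fun μ y => e4OfKW N K S M W μ y ν y') ((N' : ℤ) • Y + toSite v) =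
      (cH' * ξ) • conjV (mmRead N (K2OfK K N S M ν y')) (diagK (∑ v ∈ box (d + 1) N', legInd ρ' ((N' : ℤ) • Y + toSite v)))
        - cH' • ∑ v ∈ box (d + 1) N', mmRead N (comp (comp K (𝒩 ((N' : ℤ) • Y + toSite v) ν y')) K) := by
  simp_rw [divV_e4OfKW_eq hK h𝕄 hE hR hDl hWl hr ξ hX hEX hD h𝒩 hWd ρ']
  rw [Finset.sum_sub_distrib, smul_sub, ← Finset.smul_sum, smul_smul, ← conjV_diagK_sum]

/-- [folklore] `divV` is homogeneous: `divV (a • F) = a • divV F`. -/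
theorem divV_smul (a : ℝ) (F : Fin (d + 1) → (Fin (d + 1) → ℤ) → MKer (d + 1) (Fib d)) (y : Fin (d + 1) → ℤ) :
    divV (fun μ y => a • F μ y) y = a • divV F y := by
  simp only [KernelWard.divV, Finset.smul_sum, smul_sub]

/-- [folklore] **THE (T2-S₂)-SHAPED TABLE LAW OF THE `e4OfKW` SECTOR AT THE NEXT LEVEL.**  With the next level's first-order letter
`a₁ • mmRead N (K2OfK K N S M ν y′)`, the sector `a₂ • e4OfKW N K S M W`, the next generator `X′ Y = diagK (ξ′ • Σ_{v ∈ box N′} legInd ρ′ (N′•Y + v))`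
and ONE scalar lock `cH′·a₂·ξ = a₁·ξ′`:
`cH′ • Σ_v divV (a₂ • e4OfKW …) (N′•Y + v) = comp (a₁ • T′) (X′ Y) − comp (X′ Y) (a₁ • T′) + R Y ν y′`,
`R Y ν y′ := −(cH′·a₂) • Σ_v mmRead N (K∘𝒩 (N′•Y + v) ν y′∘K)` — exactly the `hS₂` / `hS₂''` shape of `KernelWardSymAssembly` for this sector,
with the remainder DISPLAYED. -/
theorem tableLaw_e4OfKW_sector {K 𝕄 E : MKer (d + 1) (Fib d)} (hK : Spr K) (h𝕄 : Spr 𝕄) (hE : Spr E) (hR : RelInv K 𝕄 E)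
    {S M : Fin (d + 1) → (Fin (d + 1) → ℤ) → MKer (d + 1) (Fib d)} (hDl : ∀ μ y, Loc (dM K N S M μ y))
    {W : Fin (d + 1) → (Fin (d + 1) → ℤ) → Fin (d + 1) → (Fin (d + 1) → ℤ) → MKer (d + 1) (Fib d)} (hWl : ∀ μ y ν y', Loc (W μ y ν y'))
    {r : Fin (d + 1) → ℕ} (hr : r ∈ box (d + 1) N) (ξ : ℝ)
    (hX : ∀ y : Fin (d + 1) → ℤ, Loc (diagK (ξ • ∑ v ∈ box (d + 1) N, legInd (toSite r) ((N : ℤ) • y + toSite v))))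
    (hEX : ∀ y : Fin (d + 1) → ℤ, comp E (diagK (ξ • ∑ v ∈ box (d + 1) N, legInd (toSite r) ((N : ℤ) • y + toSite v))) =
      comp (diagK (ξ • ∑ v ∈ box (d + 1) N, legInd (toSite r) ((N : ℤ) • y + toSite v))) E)
    (hD : ∀ y : Fin (d + 1) → ℤ, divV (dM K N S M) y = conjV 𝕄 (diagK (ξ • ∑ v ∈ box (d + 1) N, legInd (toSite r) ((N : ℤ) • y + toSite v))))
    {𝒩 : (Fin (d + 1) → ℤ) → Fin (d + 1) → (Fin (d + 1) → ℤ) → MKer (d + 1) (Fib d)} (h𝒩 : ∀ y ν y', Loc (𝒩 y ν y'))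
    (hWd : ∀ (y : Fin (d + 1) → ℤ) (ν : Fin (d + 1)) (y' : Fin (d + 1) → ℤ), divW W y ν y' =
      conjV (dM K N S M ν y') (diagK (ξ • ∑ v ∈ box (d + 1) N, legInd (toSite r) ((N : ℤ) • y + toSite v))) + 𝒩 y ν y')
    {cH' a₁ a₂ ξ' : ℝ} (hlock : cH' * a₂ * ξ = a₁ * ξ') (N' : ℕ) (ρ' Y : Fin (d + 1) → ℤ) (ν : Fin (d + 1)) (y' : Fin (d + 1) → ℤ) :
    cH' • ∑ v ∈ box (d + 1) N', divV (fun μ y => a₂ • e4OfKW N K S M W μ y ν y') ((N' : ℤ) • Y + toSite v) =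
      comp (a₁ • mmRead N (K2OfK K N S M ν y')) (diagK (ξ' • ∑ v ∈ box (d + 1) N', legInd ρ' ((N' : ℤ) • Y + toSite v)))
        - comp (diagK (ξ' • ∑ v ∈ box (d + 1) N', legInd ρ' ((N' : ℤ) • Y + toSite v))) (a₁ • mmRead N (K2OfK K N S M ν y'))
        + -(cH' * a₂) • ∑ v ∈ box (d + 1) N', mmRead N (comp (comp K (𝒩 ((N' : ℤ) • Y + toSite v) ν y')) K) := by
  have hdiv : ∀ u : Fin (d + 1) → ℤ, divV (fun μ y => a₂ • e4OfKW N K S M W μ y ν y') u = a₂ • divV (fun μ y => e4OfKW N K S M W μ y ν y') u :=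
    fun u => divV_smul a₂ (fun μ y => e4OfKW N K S M W μ y ν y') u
  have hc : comp (a₁ • mmRead N (K2OfK K N S M ν y')) (diagK (ξ' • ∑ v ∈ box (d + 1) N', legInd ρ' ((N' : ℤ) • Y + toSite v)))
      - comp (diagK (ξ' • ∑ v ∈ box (d + 1) N', legInd ρ' ((N' : ℤ) • Y + toSite v))) (a₁ • mmRead N (K2OfK K N S M ν y')) =
      (a₁ * ξ') • conjV (mmRead N (K2OfK K N S M ν y')) (diagK (∑ v ∈ box (d + 1) N', legInd ρ' ((N' : ℤ) • Y + toSite v))) := by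
    rw [← smul_smul, ← conjV_diagK_smul, ← conjV_smul_diagK]; rfl
  simp_rw [hdiv]
  rw [← Finset.smul_sum, smul_smul, blockLaw_e4OfKW hK h𝕄 hE hR hDl hWl hr ξ hX hEX hD h𝒩 hWd (cH' * a₂) N' ρ' Y ν y', hlock, hc, neg_smul,
    sub_eq_add_neg]

end Block


end Summit.QuantumFields.BalabanUV.Beta.WardLocusQuartic

end
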